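import Summits.CriticalPhenomena.PercolationContinuityZ3.Theorems.PercAnnulusCrossingSymmetricSharpThreshold
import Literature.Probability.Percolation.AizenmanBarskyDifferentialInequalitiesTorus
import Mathlib.Analysis.SpecialFunctions.Pow.Real
import HarnessLib

/-!
# RSW3 lane (lead, gen 24): SYMMETRY AND SHARP THRESHOLDS, II — translation-invariant events of bond
# percolation on the discrete torus `(ℤ/Lℤ)^d` have sharp thresholds: window `≤ 32·log(1/ε)/(d·log L)`

builds on p205010 (kernel theorem, internal audit signed; external expert review pending) — NOT used in this file
(every `d`, every `L ≥ 3`, every `p`).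

Cell `prim-rsw3` (LANE 3), lead seat, gen 24.  Support file (`--supports stmt-CriticalPhenomena-4575`); no definitions,
no named facts, no sorries.  Part I (`…SymmetricSharpThreshold`) proved the Friedgut–Kalai theorem from INFLUENCE
SPREADING `N·I_e ≤ Σ_e I_e`; here the spreading is supplied by the translations of the torus
`torusGraph d L` (`TorusSite d L = (ℤ/Lℤ)^d`; `GhostField.torusTranslate t` is a graph automorphism):

* `sub_ne_sub_of_torusGraph_adj`, `torusTranslate_edge_injective` — for `L ≥ 3` the `L^d` translates of a torus edge are pairwise distinct
  (`s(x+t, y+t) = s(x+t', y+t')` with `t ≠ t'` forces `x − y = y − x`, impossible for `y = x ± e_i` unless `L ∣ 2`);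
* **`torus_card_mul_real_isPivotal_le_sum`** — for an event `A` invariant under all translations:
  `L^d · P_p(e pivotal for A) ≤ Σ_{e' ∈ E(T)} P_p(e' pivotal for A)` for every torus edge `e` (part I's
  `card_mul_real_isPivotal_le_sum`): on the torus no edge carries more than a `1/L^d` fraction of the total influence;
* **`torus_log_mul_le_sum_pivotal`** — hence, for `A` increasing, determined by the torus edges and translation
  invariant, `1 ≤ M`, `M⁴ ≤ L^d`, `0 < p < 1`: `P_p(A)(1−P_p(A)) ≥ 1/M ⇒ (log M/2)·P_p(A)(1−P_p(A)) ≤ dP_p(A)/dp`;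
* **`torus_one_sub_le_real`** — THE FRIEDGUT–KALAI THEOREM ON THE TORUS: `2/M ≤ ε ≤ P_p(A)`, `0 < p ≤ q < 1`,
  `q ≥ p + 8·log(1/ε)/log M` ⇒ `P_q(A) ≥ 1 − ε`;
* **`torus_one_sub_le_real_rpow`** — the same with the optimal `M = L^{d/4}`: `2·L^{−d/4} ≤ ε ≤ P_p(A)` and
  `q ≥ p + 32·log(1/ε)/(d·log L)` ⇒ `P_q(A) ≥ 1 − ε` — EVERY TRANSLATION-INVARIANT INCREASING EVENT OF THE TORUS PASSES
  FROM PROBABILITY `ε` TO `1 − ε` WITHIN A WINDOW OF WIDTH `32·log(1/ε)/(d·log L)` (Friedgut–Kalai 1996 Thm. 2.1 for the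
  product measures `P_p` on `{0,1}^{E(T)}` and the translation group; Bollobás–Riordan 2006 Ch. 2 Thm. 13).

References: E. Friedgut, G. Kalai, Proc. AMS 124 (1996) Thm. 2.1, §3; B. Bollobás, O. Riordan, *Percolation* (2006)
Ch. 2 Thm. 13; M. Talagrand, Ann. Probab. 22 (1994) Cor. 1.2; G. Grimmett, *Percolation* (1999) §1.6, §5.3 (the torus).
-/

noncomputable section

namespace Summit.CriticalPhenomena.PercolationContinuityZ3.Theorems.Crossing

open MeasureTheory Literature.Probability.LatticeModels Literature.Probability.Percolation SimpleGraph
open Literature.Probability.Percolation.GhostField (torusTranslate)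

variable {d L : ℕ}

/-! ## §1 Translates of a torus edge are distinct -/

/-- The translate of a pair: `sym2Equiv (torusTranslate t) s(x, y) = s(x + t, y + t)`. [folklore] -/
theorem sym2Equiv_torusTranslate_mk (t x y : TorusSite d L) :
    sym2Equiv (torusTranslate t).toEquiv s(x, y) = s(x + t, y + t) := rfl

/-- For adjacent torus sites `x ∼ y` (`L ≥ 3`): `x − y ≠ y − x` (as `2 ≠ 0` in `ℤ/Lℤ`). [folklore] -/
theorem sub_ne_sub_of_torusGraph_adj (hL : 3 ≤ L) {x y : TorusSite d L} (hxy : (torusGraph d L).Adj x y) :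
    x - y ≠ y - x := by
  have two_ne_zero_zmod : (2 : ZMod L) ≠ 0 := by
    haveI : NeZero L := ⟨by omega⟩
    intro h
    have h' : ((2 : ℕ) : ZMod L) = 0 := by exact_mod_cast h
    rw [ZMod.natCast_eq_zero_iff] at h'
    have := Nat.le_of_dvd (by norm_num) h'
    omega
  intro h
  rw [torusGraph_adj_iff] at hxy
  obtain ⟨-, ⟨i, hi⟩ | ⟨i, hi⟩⟩ := hxy
  · have h3 := congrFun h i
    rw [hi] at h3
    simp only [Pi.sub_apply, Pi.add_apply, Pi.single_eq_same] at h3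
    have h4 : (2 : ZMod L) = 0 := by linear_combination -h3
    exact two_ne_zero_zmod h4
  · have h3 := congrFun h i
    rw [hi] at h3
    simp only [Pi.sub_apply, Pi.add_apply, Pi.single_eq_same] at h3
    have h4 : (2 : ZMod L) = 0 := by linear_combination h3
    exact two_ne_zero_zmod h4

/-- **The `L^d` translates of a torus edge are pairwise distinct** (`L ≥ 3`). [folklore] -/
theorem torusTranslate_edge_injective (hL : 3 ≤ L) {e : Sym2 (TorusSite d L)}
    (he : e ∈ (torusGraph d L).edgeSet) :
    Function.Injective fun t : TorusSite d L => sym2Equiv (torusTranslate t).toEquiv e := by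
  induction e using Sym2.ind with
  | h x y =>
    have hxy : (torusGraph d L).Adj x y := by rwa [SimpleGraph.mem_edgeSet] at he
    intro t t' htt'
    simp only [sym2Equiv_torusTranslate_mk, Sym2.eq_iff] at htt'
    rcases htt' with ⟨h1, -⟩ | ⟨h1, h2⟩
    · exact add_left_cancel h1
    · exfalso
      apply sub_ne_sub_of_torusGraph_adj hL hxy
      have e1 : x - y = t' - t := sub_eq_sub_iff_add_eq_add.2 (by rw [h1, add_comm])
      have e2 : y - x = t' - t := sub_eq_sub_iff_add_eq_add.2 (by rw [h2, add_comm])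
      rw [e1, e2]

/-! ## §2 Spreading on the torus and the Friedgut–Kalai theorem -/

/-- The torus `(ℤ/Lℤ)^d` has `L^d` sites. [folklore] -/
theorem card_torusSite [NeZero L] : Fintype.card (TorusSite d L) = L ^ d := by
  rw [Fintype.card_fun, ZMod.card, Fintype.card_fin]

/-- **SPREADING ON THE TORUS**: if the event `A` is invariant under every translation of the torus
(`{ω | ω + t ∈ A} = A`), then for every torus edge `e` and every `p`:
`L^d · P_p(e pivotal for A) ≤ Σ_{e' ∈ E(T)} P_p(e' pivotal for A)` (`L ≥ 3`). [cite: FriedgutKalai1996, §3] -/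
theorem torus_card_mul_real_isPivotal_le_sum [NeZero L] (hL : 3 ≤ L) {A : Set (BondConfig (TorusSite d L))}
    (hinv : ∀ t : TorusSite d L, BondConfig.relabel (sym2Equiv (torusTranslate t).toEquiv) ⁻¹' A = A)
    (p : unitInterval) {e : Sym2 (TorusSite d L)} (he : e ∈ (torusGraph d L).edgeFinset) :
    ((L : ℝ) ^ d) * (bondPercolation (torusGraph d L) p).real {ω | IsPivotal A e ω} ≤
      ∑ e' ∈ (torusGraph d L).edgeFinset, (bondPercolation (torusGraph d L) p).real {ω | IsPivotal A e' ω} := by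
  classical
  have h := card_mul_real_isPivotal_le_sum (G := torusGraph d L) (F := (torusGraph d L).edgeFinset)
    (Finset.univ : Finset (TorusSite d L)) (fun t => torusTranslate t) p (fun t _ => hinv t)
    (fun t _ e' he' => by
      rw [SimpleGraph.mem_edgeFinset] at he' ⊢
      exact (sym2Equiv_mem_edgeSet_iff (torusTranslate t) e').2 he')
    (fun e' he' => by
      rw [SimpleGraph.mem_edgeFinset] at he'
      exact (torusTranslate_edge_injective hL he').injOn) he
  rw [Finset.card_univ, card_torusSite] at h
  exact_mod_cast h

/-- **THE DIFFERENTIAL INEQUALITY ON THE TORUS** (`L ≥ 3`, every `d`, `0 < p < 1`, `1 ≤ M`, `M⁴ ≤ L^d`): for an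
increasing event `A` determined by the torus edges and invariant under all translations, if `P_p(A)(1−P_p(A)) ≥ 1/M`
then `(log M / 2)·P_p(A)(1−P_p(A)) ≤ Σ_{e∈E(T)} P_p(e pivotal) = dP_p(A)/dp`.
[cite: FriedgutKalai1996, Thm. 2.1] [cite: Talagrand1994, Cor. 1.2] -/
theorem torus_log_mul_le_sum_pivotal [NeZero L] (hL : 3 ≤ L) {A : Set (BondConfig (TorusSite d L))}
    (hA : IsUpperSet A) (hAF : DeterminedBy A (torusGraph d L).edgeSet)
    (hinv : ∀ t : TorusSite d L, BondConfig.relabel (sym2Equiv (torusTranslate t).toEquiv) ⁻¹' A = A)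
    (p : unitInterval) (hp0 : 0 < (p : ℝ)) (hp1 : (p : ℝ) < 1) {M : ℝ} (hM : 1 ≤ M) (hML : M ^ 4 ≤ (L : ℝ) ^ d)
    (ht : 1 / M ≤ (bondPercolation (torusGraph d L) p).real A * (1 - (bondPercolation (torusGraph d L) p).real A)) :
    Real.log M / 2 * ((bondPercolation (torusGraph d L) p).real A * (1 - (bondPercolation (torusGraph d L) p).real A)) ≤
      ∑ e ∈ (torusGraph d L).edgeFinset, (bondPercolation (torusGraph d L) p).real {ω | IsPivotal A e ω} := by
  classical
  have hF : (↑(torusGraph d L).edgeFinset : Set (Sym2 (TorusSite d L))) ⊆ (torusGraph d L).edgeSet := by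
    rw [SimpleGraph.coe_edgeFinset]
  have hAF' : DeterminedBy A (↑(torusGraph d L).edgeFinset : Set (Sym2 (TorusSite d L))) := by
    rwa [SimpleGraph.coe_edgeFinset]
  exact log_mul_le_sum_pivotal_of_spread hF hA hAF' p hp0 hp1 hM hML
    (fun e he => torus_card_mul_real_isPivotal_le_sum hL hinv p he) ht

/-- **THE FRIEDGUT–KALAI THEOREM ON THE TORUS** (`L ≥ 3`, every `d`; `1 ≤ M`, `M⁴ ≤ L^d`): for an increasing event
`A` determined by the torus edges and invariant under all translations, if `2/M ≤ ε ≤ P_p(A)`, `0 < p ≤ q < 1` and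
`q ≥ p + 8·log(1/ε)/log M`, then **`P_q(A) ≥ 1 − ε`**.
[cite: FriedgutKalai1996, Thm. 2.1] [cite: BollobasRiordan2006, Ch. 2, Thm. 13] -/
theorem torus_one_sub_le_real [NeZero L] (hL : 3 ≤ L) {A : Set (BondConfig (TorusSite d L))}
    (hA : IsUpperSet A) (hAF : DeterminedBy A (torusGraph d L).edgeSet)
    (hinv : ∀ t : TorusSite d L, BondConfig.relabel (sym2Equiv (torusTranslate t).toEquiv) ⁻¹' A = A)
    {M : ℝ} (hM : 1 ≤ M) (hML : M ^ 4 ≤ (L : ℝ) ^ d) {ε : ℝ} (hεM : 2 / M ≤ ε) {p q : unitInterval}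
    (hp0 : 0 < (p : ℝ)) (hq1 : (q : ℝ) < 1) (hpq : p ≤ q) (hstart : ε ≤ (bondPercolation (torusGraph d L) p).real A)
    (hwin : (p : ℝ) + 8 * Real.log (1 / ε) / Real.log M ≤ q) :
    1 - ε ≤ (bondPercolation (torusGraph d L) q).real A := by
  classical
  have hF : (↑(torusGraph d L).edgeFinset : Set (Sym2 (TorusSite d L))) ⊆ (torusGraph d L).edgeSet := by
    rw [SimpleGraph.coe_edgeFinset]
  have hAF' : DeterminedBy A (↑(torusGraph d L).edgeFinset : Set (Sym2 (TorusSite d L))) := by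
    rwa [SimpleGraph.coe_edgeFinset]
  exact one_sub_le_real_of_spread hF hA hAF' hM hML
    (fun r _ _ e he => torus_card_mul_real_isPivotal_le_sum hL hinv r he) hεM hp0 hq1 hpq hstart hwin

/-- `(L^{d/4})⁴ = L^d`. [folklore] -/
theorem rpow_div_four_pow_four (hL0 : 0 < L) : ((L : ℝ) ^ ((d : ℝ) / 4)) ^ 4 = (L : ℝ) ^ d := by
  have hL' : (0 : ℝ) ≤ L := by positivity
  rw [← Real.rpow_natCast ((L : ℝ) ^ ((d : ℝ) / 4)) 4, ← Real.rpow_mul hL', ← Real.rpow_natCast (L : ℝ) d]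
  norm_num

/-- **THE FRIEDGUT–KALAI THEOREM ON THE TORUS, optimal exponent** (`L ≥ 3`, `d ≥ 1`): for an increasing event `A`
determined by the torus edges and invariant under all translations, if `2·L^{−d/4} ≤ ε ≤ P_p(A)`, `0 < p ≤ q < 1` and
`q ≥ p + 32·log(1/ε)/(d·log L)`, then **`P_q(A) ≥ 1 − ε`** — the window from level `ε` to level `1 − ε` of a symmetric
increasing event of the torus `(ℤ/Lℤ)^d` has width at most `32·log(1/ε)/(d·log L)`.
[cite: FriedgutKalai1996, Thm. 2.1] [cite: BollobasRiordan2006, Ch. 2, Thm. 13] -/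
theorem torus_one_sub_le_real_rpow [NeZero L] (hL : 3 ≤ L) (hd : 1 ≤ d) {A : Set (BondConfig (TorusSite d L))}
    (hA : IsUpperSet A) (hAF : DeterminedBy A (torusGraph d L).edgeSet)
    (hinv : ∀ t : TorusSite d L, BondConfig.relabel (sym2Equiv (torusTranslate t).toEquiv) ⁻¹' A = A)
    {ε : ℝ} (hεL : 2 * (L : ℝ) ^ (-((d : ℝ) / 4)) ≤ ε) {p q : unitInterval}
    (hp0 : 0 < (p : ℝ)) (hq1 : (q : ℝ) < 1) (hpq : p ≤ q) (hstart : ε ≤ (bondPercolation (torusGraph d L) p).real A)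
    (hwin : (p : ℝ) + 32 * Real.log (1 / ε) / (d * Real.log L) ≤ q) :
    1 - ε ≤ (bondPercolation (torusGraph d L) q).real A := by
  have hL0 : 0 < L := by omega
  have hLr : (1 : ℝ) ≤ L := by exact_mod_cast hL0
  have hLpos : (0 : ℝ) < L := by positivity
  set M : ℝ := (L : ℝ) ^ ((d : ℝ) / 4) with hMdef
  have hM : 1 ≤ M := Real.one_le_rpow hLr (by positivity)
  have hML : M ^ 4 ≤ (L : ℝ) ^ d := (rpow_div_four_pow_four hL0).le
  have hεM : 2 / M ≤ ε := by
    have : 2 / M = 2 * (L : ℝ) ^ (-((d : ℝ) / 4)) := by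
      rw [hMdef, Real.rpow_neg hLpos.le, div_eq_mul_inv]
    rw [this]; exact hεL
  have hlogM : Real.log M = (d : ℝ) / 4 * Real.log L := by
    rw [hMdef, Real.log_rpow hLpos]
  have hwin' : (p : ℝ) + 8 * Real.log (1 / ε) / Real.log M ≤ q := by
    have hd0 : (0 : ℝ) < d := by exact_mod_cast hd
    have hlogL : 0 < Real.log L := Real.log_pos (by exact_mod_cast (by omega : 1 < L))
    have : 8 * Real.log (1 / ε) / Real.log M = 32 * Real.log (1 / ε) / (d * Real.log L) := by
      rw [hlogM]; field_simp; ring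
    rw [this]; exact hwin
  exact torus_one_sub_le_real hL hA hAF hinv hM hML hεM hp0 hq1 hpq hstart hwin'

end Summit.CriticalPhenomena.PercolationContinuityZ3.Theorems.Crossing

end
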